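import Summits.CriticalPhenomena.Ising3DConformalLimit.Theses.BallSpecification

/-!
# CriticalPhenomena / Ising3DConformalLimit — route BallSpecification, assembly

Settles item `stmt-CriticalPhenomena-5731` (rank 1, assembly of route
`route-CriticalPhenomena-BallSpecification`):

`BallSpecifiedFieldLimit → BallSpecifiedInversionUpgrade → NonGaussianLimit → Ising3DConformalLimit`.

Pure logic over the summit's structure predicates
(`Literature/Probability/LatticeModels/ConformalCovariance.lean`,
`Literature/Probability/LatticeModels/ScalingLimit3D.lean`): take the witness `(ρ, Δ, S, L, μ, γ)`
of (A) `BallSpecifiedFieldLimit` together with its hypothesis block `h`; (B)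
`BallSpecifiedInversionUpgrade`, whose premise is the body of (A) verbatim, applied to the same
tuple and `h` gives `IsInversionCovariant Δ S`; `IsMoebiusCovariant Δ S := ⟨Euclid, scale,
inversion⟩` by definition; (D) `NonGaussianLimit ρ S` gives `HasNontrivialU4 S`; with `ρ > 0` on
`(0,1]`, `Δ > 0`, the pointwise limit and non-degeneracy this is `CritIsing3DConformalLimit`
(= `Ising3DConformalLimit`). No named facts are used; the theorem is unconditional bookkeeping.
-/

namespace Summit.CriticalPhenomena.Ising3DConformalLimit.Theorems

open Summit.CriticalPhenomena.Ising3DConformalLimit.Theses.BallSpecification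
open Literature.Probability.LatticeModels

/-- Settles `stmt-CriticalPhenomena-5731` (exact signature): the assembly
`BallSpecifiedFieldLimit → BallSpecifiedInversionUpgrade → NonGaussianLimit → Ising3DConformalLimit`
of route BallSpecification. Proof: witness `(ρ, Δ, S, L, μ, γ)` and hypothesis block `h` from (A);
(B) applied to the same tuple and `h` ⇒ `IsInversionCovariant Δ S`; Möbius := ⟨Euclid, scale,
inversion⟩ (definition of `IsMoebiusCovariant`, Di Francesco–Mathieu–Sénéchal 1997 §4.3.1);
(D) ⇒ `U₄ ≢ 0`. [folklore] -/
theorem ballSpecification_assembly_proof :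
    Summit.CriticalPhenomena.Ising3DConformalLimit.Theses.BallSpecification.Assembly := by
  unfold Assembly
  intro hA hB hD
  obtain ⟨ρ, Δ, S, L, μ, γ, h⟩ := hA
  have hinv : IsInversionCovariant Δ S := hB ρ Δ S L μ γ h
  obtain ⟨hρ, hΔ, hlim, -, hnd, heuc, hsc, -⟩ := h
  have hU4 : HasNontrivialU4 S := hD ρ S hρ hlim hnd
  exact ⟨ρ, Δ, S, hρ, hΔ, hlim, hnd, ⟨heuc, hsc, hinv⟩, hU4⟩

end Summit.CriticalPhenomena.Ising3DConformalLimit.Theorems
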